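/-
Copyright (c) 2026 the pub-hodgecm-mathlib formalisation cell (harness21).  Prover seat hodgecm-mathlib-R90-C10-p08 (g0) (free S1 hand), HCML SLAB R90-TF,
section S6 «Ch. 14.1–14.5 stable trace formula» (base `R90-C14`), S6 WAVE 3 card W3-c′ (R90-C14-plan (g0) OPEN CARDS 16:50:09Z; re-timed 21:55Z after the fleet outage).  2026-09-04.
-/
import Summits.HodgeConjecture.HodgeConjecture.Theorems.R90S6HeckeEigenpolyThreeExists   -- ★ p862233 (this hand, W3-c): `exists_generator_unitaryHeckeAlgebraAdic_three`, `unitaryHeckeEigencharacterAdic_three_aeval`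
import HarnessLib

/-!
# R90 · S6 — WAVE 3 card W3-c′: every unramified HECKE EIGEN-POLYNOMIAL of `U(J₀,3)(E_w)` IS a symmetric Laurent polynomial `Q(z + z⁻¹)`
# (`Theorems/R90S6HeckeEigenpolyThreeSymmetric.lean`; the converse of ★ W3-c `exists_hecke_eigenpoly_three`)

Cell `hodgecm-mathlib`, crux H413 (`stmt-HodgeConjecture-24833`), route of record `HCCMUnconditional`; programme R90-TF, section S6 (base `R90-C14`), seat
R90-C10-p08 (g0); card W3-c′ of the sheet `R90/R90-C14-plan/g0/S6_wave3cd_targets.v1.R90-C14-plan-g0.lean` 04e65d4ba36b0ae2 :29–:34 (signature token-identical,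
namespace segment `.Wave3` dropped; AUDIT S6#W3 c∕c′∕d∕d′ CLEAN 16:50:32Z).  Helper lane `--supports stmt-HodgeConjecture-24833 --as helper`; THEOREMS ONLY; imports =
★ `Theorems.R90S6HeckeEigenpolyThreeExists` + HarnessLib.

THE MATHEMATICS [CartierCorvallis1979, §IV Thm. 4.1; Rogawski1990, §4.5 p. 45]: `ℋ(U(J₀,3)(E_w), K₀) = ℂ[T₁]` (★ `exists_generator_unitaryHeckeAlgebraAdic_three`), so
`φ = Q(T₁)` for a polynomial `Q`, and `λ_{(z,1,1)}(Q(T₁)) = Q(z + z⁻¹)` (★ `unitaryHeckeEigencharacterAdic_three_aeval`): the eigen-polynomial `z ↦ λ_{(z,1,1)}(φ)` is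
`Q(z + z⁻¹)` — the `W`-symmetry `z ↦ z⁻¹` of the Satake parameter.
* **`hecke_eigenpoly_three_symmetric`** — W3-c′.
HONEST LABEL: local spherical Hecke algebra bookkeeping; proves no printed global statement.  HC_CM is proved only modulo the 7 printed citations (2 remaining
named inputs: hLiu418 = stmt-HodgeConjecture-24832, h413 = stmt-HodgeConjecture-24833) until rung 0 closes; count-neutral helper.

## References
* [CartierCorvallis1979] P. Cartier, *Representations of 𝔭-adic groups: a survey*, PSPM 33.1 (1979), §IV Thm. 4.1, Cor. 4.2.
* [Rogawski1990] J. D. Rogawski, *Automorphic Representations of Unitary Groups in Three Variables*, Ann. of Math. Stud. 123 (1990), §4.5 p. 45, p. 55.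
* [Minguez2011] A. Mínguez, *Unramified representations of unitary groups* (2011), §4.
-/

set_option autoImplicit false
-- the mandated namespace repeats the single-problem summit's segment (`HodgeConjecture.HodgeConjecture`)
set_option linter.dupNamespace false

noncomputable section

open NumberField IsDedekindDomain Polynomial
open Literature.NumberTheory.Automorphic Literature.NumberTheory.Automorphic.HermitianLattice Literature.NumberTheory.Automorphic.UnitaryGroup

namespace Summit.HodgeConjecture.HodgeConjecture.R90.S6

variable {F E : Type} [Field F] [NumberField F] [Field E] [NumberField E] [Algebra F E] [Algebra.IsQuadraticExtension F E]
  (c : E ≃ₐ[F] E) (hc1 : c ≠ 1) (v : HeightOneSpectrum (𝓞 F)) (w : PlacesOver E v) (hw : c • w.1 = w.1)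
  (hv : Algebra.IsUnramifiedIn (𝓞 E) v.asIdeal)

/-- **W3-c′ — every Hecke eigen-polynomial of `U(J₀,3)(E_w)` is of the form `Q(z + z⁻¹)`**: for every `φ ∈ ℋ(U(J₀,3)(E_w), K₀)` there is `Q ∈ ℂ[X]` with
`λ_{(z,1,1)}(φ) = Q(z + z⁻¹)` for all `z ∈ ℂˣ` (write `φ = Q(T₁)`).  (Sheet `S6_wave3cd_targets.v1` :29–:34 token-for-token.)
[cite: CartierCorvallis1979, §IV Thm. 4.1, Cor. 4.2] [cite: Rogawski1990, §4.5 p. 45] [cite: Minguez2011, §4] -/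
theorem hecke_eigenpoly_three_symmetric
    (φ : heckeAlgebra ℂ ↥(unitaryGroupOfForm (galAdicCompletionMap (L := E) c hw) ((StdForm.antidiagonal 3).over (w.1.adicCompletion E)))
      (unitaryInt (galAdicCompletionMap (L := E) c hw) ((StdForm.antidiagonal 3).over (w.1.adicCompletion E)))) :
    ∃ Q : ℂ[X], ∀ z : ℂˣ, unitaryHeckeEigencharacterAdic c hc1 v w hw hv ![z, 1, 1] φ = Q.eval ((z : ℂ) + (z : ℂ)⁻¹) := by
  obtain ⟨T₁, hT₁, hgen⟩ := exists_generator_unitaryHeckeAlgebraAdic_three c hc1 v w hw hv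
  obtain ⟨Q, rfl⟩ := hgen φ
  exact ⟨Q, fun z => unitaryHeckeEigencharacterAdic_three_aeval c hc1 v w hw hv hT₁ Q z⟩

end Summit.HodgeConjecture.HodgeConjecture.R90.S6

end
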